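import Literature.Combinatorics.Designs.GoethalsSeidelArray

/-!
# The Williamson array

[Williamson, Duke Math. J. 11 (1944) 65–81] (`Williamson1944`): if `A, B, C, D` are symmetric, pairwise commuting
matrices over a commutative ring with `A² + B² + C² + D² = m·I` then the array

  `W = [[ A,  B,  C,  D],
        [-B,  A, -D,  C],
        [-C,  D,  A, -B],
        [-D, -C,  B,  A]]`

satisfies `W Wᵀ = m·I` (`wMatrix_mul_transpose`).  Symmetric circulants commute, so four symmetric `±1` circulant
first rows ("Williamson sequences") `a, b, c, d : ZMod n → ℤ` whose periodic autocorrelations sum to `0` at every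
non-zero shift give a Hadamard matrix of order `4n` (`williamson_isHadamard`) — a "Williamson matrix".  This is the
array `williamsonArray` of the cell's kernel verifier (`Summits/Ventures/DiscreteObjects/Verify/HadamardKernel.lean`)
and the sub-family "Williamson-type" of the Hadamard-668 census (v = 167); the Goethals–Seidel array
(`GoethalsSeidelArray.lean`) removes the symmetry hypothesis.  Our formalisation of the published construction, indexed
by `Fin 4 × ι`; `IsHadamardMatrix`, `gram`, `circT` are reused from `GoethalsSeidelArray`.  No `sorry`, no new axioms.
-/

open Matrix BigOperators Finset

namespace Literature.Combinatorics.Designs.Williamson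

open Literature.Combinatorics.Designs.LegendrePairs (PAF IsPM)
open Literature.Combinatorics.Designs.GoethalsSeidel (IsHadamardMatrix gram_of_paf circT)

section General

variable {ι : Type*} [Fintype ι] [DecidableEq ι] {α : Type*} [CommRing α]

/-- the sixteen blocks of the Williamson array. [cite: Williamson1944, the array] -/
def wBlocks (A B C D : Matrix ι ι α) : Fin 4 → Fin 4 → Matrix ι ι α :=
  ![![A, B, C, D], ![-B, A, -D, C], ![-C, D, A, -B], ![-D, -C, B, A]]

/-- the Williamson array as a matrix indexed by `Fin 4 × ι`. [cite: Williamson1944, the array] -/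
def wMatrix (A B C D : Matrix ι ι α) : Matrix (Fin 4 × ι) (Fin 4 × ι) α :=
  Matrix.of fun p q => wBlocks A B C D p.1 q.1 p.2 q.2

omit [DecidableEq ι] in
/-- block form of `W Wᵀ`. [folklore] -/
private lemma wMatrix_mul_transpose_apply (A B C D : Matrix ι ι α) (p r : Fin 4) (i k : ι) :
    (wMatrix A B C D * (wMatrix A B C D)ᵀ) (p, i) (r, k) =
      (∑ q, wBlocks A B C D p q * (wBlocks A B C D r q)ᵀ) i k := by
  simp only [wMatrix, mul_apply, transpose_apply, of_apply, Fintype.sum_prod_type, Matrix.sum_apply]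

omit [DecidableEq ι] in
/-- **the Williamson block identities**: for symmetric pairwise commuting blocks,
`Σ_q W_{pq} W_{rq}ᵀ = [p = r] · (A² + B² + C² + D²)`. [cite: Williamson1944, the array] -/
theorem w_block_identity (A B C D : Matrix ι ι α) (hA : Aᵀ = A) (hB : Bᵀ = B) (hC : Cᵀ = C) (hD : Dᵀ = D)
    (hAB : B * A = A * B) (hAC : C * A = A * C) (hAD : D * A = A * D) (hBC : C * B = B * C)
    (hBD : D * B = B * D) (hCD : D * C = C * D) (p r : Fin 4) :
    ∑ q, wBlocks A B C D p q * (wBlocks A B C D r q)ᵀ =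
      if p = r then A * A + B * B + C * C + D * D else 0 := by
  fin_cases p <;> fin_cases r <;>
    simp [wBlocks, Fin.sum_univ_four, Matrix.transpose_neg, hA, hB, hC, hD, hAB, hAC, hAD, hBC, hBD, hCD] <;>
    abel

/-- **Williamson (1944).** Symmetric pairwise commuting `A, B, C, D` with `A² + B² + C² + D² = m·I` give
`W Wᵀ = m·I` for the Williamson array `W`. [cite: Williamson1944, the array] -/
theorem wMatrix_mul_transpose (A B C D : Matrix ι ι α) (m : α) (hA : Aᵀ = A) (hB : Bᵀ = B) (hC : Cᵀ = C)
    (hD : Dᵀ = D) (hAB : B * A = A * B) (hAC : C * A = A * C) (hAD : D * A = A * D) (hBC : C * B = B * C)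
    (hBD : D * B = B * D) (hCD : D * C = C * D) (h : A * A + B * B + C * C + D * D = m • (1 : Matrix ι ι α)) :
    wMatrix A B C D * (wMatrix A B C D)ᵀ = m • (1 : Matrix (Fin 4 × ι) (Fin 4 × ι) α) := by
  ext ⟨p, i⟩ ⟨r, k⟩
  rw [wMatrix_mul_transpose_apply, w_block_identity A B C D hA hB hC hD hAB hAC hAD hBC hBD hCD]
  by_cases hpr : p = r
  · subst hpr
    rw [if_pos rfl, h]
    simp [Matrix.one_apply]
  · have : (p, i) ≠ (r, k) := fun e => hpr (Prod.mk.inj e).1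
    simp [hpr, this]

end General

/-! ## Williamson sequences: symmetric `±1` circulant first rows -/

section Sequences

variable {n : ℕ} [NeZero n]

omit [NeZero n] in
/-- a symmetric first row gives a symmetric circulant: `(circulant x)ᵀ = circulant x`. [cite: Williamson1944, the array (symmetric circulants)] -/
lemma transpose_circulant_of_symm (x : ZMod n → ℤ) (hx : ∀ i, x (-i) = x i) :
    (circulant x)ᵀ = circulant x := by
  rw [transpose_circulant]; exact congrArg circulant (funext hx)

omit [NeZero n] in
/-- for a symmetric first row, `circT x = circulant x`. [cite: Williamson1944, the array (symmetric circulants)] -/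
lemma circT_of_symm (x : ZMod n → ℤ) (hx : ∀ i, x (-i) = x i) : circT x = circulant x :=
  congrArg circulant (funext hx)

omit [NeZero n] in
/-- the entries of the Williamson array on `±1` circulants are `±1`. [cite: Williamson1944, the array] -/
lemma wMatrix_pm (a b c d : ZMod n → ℤ) (ha : IsPM a) (hb : IsPM b) (hc : IsPM c) (hd : IsPM d)
    (P Q : Fin 4 × ZMod n) :
    wMatrix (circulant a) (circulant b) (circulant c) (circulant d) P Q = 1 ∨
      wMatrix (circulant a) (circulant b) (circulant c) (circulant d) P Q = -1 := by
  have hneg : ∀ x : ZMod n → ℤ, IsPM x → ∀ t, -x t = 1 ∨ -x t = -1 := fun x hx t => by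
    rcases hx t with h | h
    · right; rw [h]
    · left; rw [h]; norm_num
  obtain ⟨p, i⟩ := P
  obtain ⟨q, j⟩ := Q
  simp only [wMatrix, of_apply]
  fin_cases p <;> fin_cases q <;>
    simp only [wBlocks, Fin.zero_eta, Fin.mk_one, Fin.isValue, Matrix.cons_val_zero, Matrix.cons_val_one,
      Matrix.neg_apply, circulant_apply] <;>
    first
      | exact ha _ | exact hb _ | exact hc _ | exact hd _
      | exact hneg a ha _ | exact hneg b hb _ | exact hneg c hc _ | exact hneg d hd _

/-- **Williamson matrices are Hadamard.** Four symmetric `±1` sequences `a, b, c, d` on `ZMod n`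
(`x (-i) = x i`) with `PAF_a(s) + PAF_b(s) + PAF_c(s) + PAF_d(s) = 0` for all `s ≠ 0` give, through the Williamson
array, a Hadamard matrix of order `4n`. [cite: Williamson1944, the array] -/
theorem williamson_isHadamard (a b c d : ZMod n → ℤ) (ha : IsPM a) (hb : IsPM b) (hc : IsPM c) (hd : IsPM d)
    (sa : ∀ i, a (-i) = a i) (sb : ∀ i, b (-i) = b i) (sc : ∀ i, c (-i) = c i) (sd : ∀ i, d (-i) = d i)
    (hs : ∀ s : ZMod n, s ≠ 0 → PAF a s + PAF b s + PAF c s + PAF d s = 0) :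
    IsHadamardMatrix (wMatrix (circulant a) (circulant b) (circulant c) (circulant d)) := by
  refine ⟨wMatrix_pm a b c d ha hb hc hd, ?_⟩
  have hcard : (Fintype.card (Fin 4 × ZMod n) : ℤ) = 4 * n := by simp [Fintype.card_prod, ZMod.card]
  rw [hcard]
  have hg := gram_of_paf a b c d ha hb hc hd hs
  rw [Literature.Combinatorics.Designs.GoethalsSeidel.gram, circT_of_symm a sa, circT_of_symm b sb, circT_of_symm c sc, circT_of_symm d sd] at hg
  exact wMatrix_mul_transpose _ _ _ _ _ (transpose_circulant_of_symm a sa) (transpose_circulant_of_symm b sb)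
    (transpose_circulant_of_symm c sc) (transpose_circulant_of_symm d sd) (circulant_mul_comm b a)
    (circulant_mul_comm c a) (circulant_mul_comm d a) (circulant_mul_comm c b) (circulant_mul_comm d b)
    (circulant_mul_comm d c) hg

end Sequences

end Literature.Combinatorics.Designs.Williamson
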